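import Summits.QuantumFields.YangMills.Theorems.BalabanUVNodesN05SubBP2DK2T8SrvGammaPrime
import Literature.MathematicalPhysics.QuantumFieldTheory.Balaban1983to89.B8LeafKnitZdGF3P2GammaPrime
import Literature.MathematicalPhysics.QuantumFieldTheory.Balaban1983to89.B8Prop3PrintedZdGF3P2Gamma
import Literature.MathematicalPhysics.QuantumFieldTheory.Balaban1983to89.B8SockSP5UniformThresholdsSrcGammaPrime
import Literature.MathematicalPhysics.QuantumFieldTheory.Balaban1983to89.B8Prop7TowerAxialRecordP
import Literature.MathematicalPhysics.QuantumFieldTheory.Balaban1983to89.B9SupplySockB9P3ZdGammaUnivDelta2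
import Literature.MathematicalPhysics.QuantumFieldTheory.Balaban1983to89.Node00.CarriersB8SubD

/-!
# EDITION «K2» (director-ym №227 (b′-2), plan YMPLAN-G87-N05-GO (R2); dag-n05-d g14, 2026-08-28): this module RE-KEYED onto PRINT's (1.3)–(1.4) CLASS AT THE PINNED BLOCK SIZE —
# the index `Node00.IdxB8SubD θ` ↦ dag-n05-w1's cut `Node00.IdxB8SubDκ θ Mκ Rκ = {j : IdxB8SubD θ ∕∕ Admissible134 θ.L Mκ Rκ k Ω}` (one more `.1` in every accessor, the new `j.2` =
# the print-class law), and EVERY [Balaban1985BackgroundPropagators]-type binder gains print's literal (1.3)–(1.4) «`Admissible134 θ.L Mκ Rκ i.k i.Ω`» as ONE extra member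
# hypothesis right after the (1.5) law (N06 serves ONLY print's class — Q-SG1 «SURVIVES»); extra parameters `(Mκ Rκ : ℕ)`; proof terms = the «P₂D» ones token for token
# (generator `gen_k2.py` on the tree bytes).  The rest of this header is the «P₂D» header VERBATIM.
# BalabanUVNodes ∕ N05 ([Balaban1985RegularSpaces] Lemma 1 p. 79 – Thm 8 p. 101): THE «P₂C» KNIT — the re-typed [B8] leaf `B8LeafKnitRSC.B8LeafRSC` (Proposition 7 in
# the repaired-constant currency `C₇ := 530·D·L²`, axial map PINNED to print's tower map `toAxialTowerResid`) over the COLLAR (admissible, (1.3)–(1.4)) sub-family of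
# the four-law `Ω₀ = ℤᵈ` sub-index on the EDITION-δ₂ carrier `zdGF3HP₂` (Hölder member of (1.36) «on Ω_j»), knit on the γ′ socket family with [4]'s b9 sockets in
# print's BOTH-POINTS Hölder class — **PROPOSITION 7 SERVED** (dag-n05-w1 `prop7RepairedC_famB8OfRecordSubBP_toAxialTower_domainSeq`, p602967), Lemma 1,
# Thm 2, Prop 3, Thm 4, Thm 8-surviving from tree theorems; Proposition 5 ∃∕! (at `lan`) and Proposition 6 (at `c₁`, all `CubeB8` cubes) DISPLAYED — D9b₂C, PIN-FREE:
# NODE 00's pin `Node00.CarriersB8SubBP2C.B8LeafOfRecordSubBP₂C θ (λ.cutSubB J lan c₁)` (dag-n05-w1) reads this conclusion by `Iff.rfl`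

EDITION «P₂D» (dag-n05-d g12, 2026-08-28; dag-n05-w1 LOCATED-SLET ∕ p613168, dag-n05-c DESIGN WORD I.30865, dag-n05-w1 `Node00/CarriersB8SubD`): the «P₂C» file of the
same name-stem RE-KEYED onto the (1.5)-obeying admissible sub-index `Node00.IdxB8SubDκ θ Mκ Rκ = {j : IdxB8SubC θ ∕∕ ∀ l < k, ∀ z ∈ Λs k l, Lˡ•z ∈ Lam θ.L Ω l}` — every
class-wide [Balaban1985BackgroundPropagators]-type binder (`SLet SLetUB SB9P SH59src SB9srcHP` and the produced Prop-5-type families) gains print's (1.5) layer law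
«`∀ l, l < i.k → ∀ z ∈ i.Λs i.k l, ((θ.L : ℤ) ^ l) • z ∈ B8ConstraintBonds.Lam θ.L i.Ω l`» as ONE extra member hypothesis right after `DomainSeq θ.L i.Ω` (the member
class of the «P₂C» binders admitted dag-n05-w1's all-`univ` datum `i⋆`, at which `SockLettersRD` is contradictory — p613168 `sLet_idxB8LawsB_unsatisfiable`; with (1.5)
conjoined `i⋆` is excluded, dag-n05-c p613464 `not_lamTop_allUniv`), and the leaf's members are the `IdxB8SubD` ones (accessors `j.1.1.1.1 ↦ j.1.1.1.1.1`, …, the new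
`j.1.2` = the (1.5) law at the member).  Proposition 6's cube family (over `IdxB8SubB`) and the pinned axial map are unchanged.  Proof terms = the «P₂C» ones token for
token.  The rest of this header is the «P₂C» header VERBATIM (read `IdxB8SubD` ∕ the (1.5)-members for `{j : IdxB8SubB θ ∕∕ DomainSeq …}` ∕ the collar law members).

Track A of `YM-PLAN.md` (cell `pub-ymgap`, HUMAN RULING D-0062), node **N05**; seat `pub-ymgap-dag-n05-d` (g11), 2026-08-28; bears on K1⁷ `stmt-QuantumFields-20542`
(`--supports … --as helper`, count-neutral).  THE STORY IN ONE PARAGRAPH.  D9b (p596490) knit NODE 00's P-slot `B8LeafOfRecordSubBP θ (λ.cutSubB J lan c₁)` from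
[4]-type sockets, displaying `p5e p5u p6 p7`.  Three located narrownesses of that slot were then repaired by ONE re-pin «P₂C» (this seat's DESIGN, dag-n05-w1's
WORD «YES + index on the existing `B8ConstraintBonds.DomainSeq`», dag-n05-e's ACK, cell bus 2026-08-28 03:12–03:13Z): №4 the Hölder member of (1.36) and line 5 of
(1.59) are printed «on Ω_j» — edition δ₂ of the carrier (`B8LeafModelZd3P2`, p599986) and dag-n06-b's both-points socket `SockB9P3H2` (p598001); the (1.4) collar
law is an INDEX law — the admissible sub-family `IdxB8SubDκ θ Mκ Rκ` (dag-n05-w2 `B8Prop7TowerAxialAdmissible`, p601036); Proposition 7's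
currency — the leaf shape `B8LeafRSC` with `p7 : Prop7RepairedC C₇` (this seat, p602607), because the tree's only Prop-7 supplier at nested `ℤᵈ` members gives
`530·D·L²` (dag-n05-w1 `B8Prop7TowerAxialCollarP` ∕ `…RecordP`, p598716 ∕ p600262) and `Prop7RepairedC C → Prop7PrintedR` needs `C ≤ 2`.  THIS FILE is D9b RE-RUN on
that sub-family, carrier and leaf shape (generator `gen_d9b2c.py` on D9b's tree bytes): the socket binders gain the antecedent `DomainSeq θ.L i.Ω` (N06 serves
fewer members), `SB9P` is typed `SockB9P3H2`, the sourced Prop-3-frame socket's Hölder line is both-points, the callees are the δ₂ twins (this seat's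
`prop3Printed_zdGF3P₂_map_γ` p600916, `t8P₂DK2_of_socketsSrc_γ'`, dag-n05-w2's `b8LeafRSC_zdGF3HP₂_mapJ_γ'` with Theorem 4 through the `Iff.rfl` transfer
`thm4Printed_zdGF3HP₂_iff`), the axial map is `toAxialTowerResid θ λ.β λ.len ∘ (·.1.1)`, and — the payoff — the `p7` binder is GONE: Proposition 7 is the tree
theorem `prop7RepairedC_famB8OfRecordSubBP_toAxialTower_domainSeq` (dag-n05-w1 p602967; collar law from `DomainSeq` by dag-n05-w2's `collar_of_domainSeq'`),
moved to `zdGF3HP₂` by `prop7RepairedC_zdGF3HP₂_iff` (Proposition 7 does not read (1.36)).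

WHAT IS PROVED (composition BY NAME; no estimate; no new definition):
* ★★★ **`b8LeafRSC_P2DK2_of_knit_lettersSrc_γ'`** — `B8LeafRSC θ.D θ.L λ.C₂ λ.B₁′ λ.inp.B₀′ λ.B₁ λ.B₂ c₁ λ.inp λ.B₀β (530·θ.D·θ.L²) (blockPairNA θ.D θ.L θ.𝔸)
  (fun j : {j : IdxB8SubB θ ∕∕ DomainSeq θ.L j.1.1.1.1.Ω} => zdGF3HP₂ θ.𝔸 θ.L λ.β λ.len j.1.1.1.1.1) lan (fun jB : IdxB8SubB θ => cubB8OfRecord θ jB.1) (toAxialTowerResid θ λ.β λ.len ∘ (·.1.1))`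
  from: [4]'s letters at the COLLAR law members (`SLet`, `SLetUB`), the sourceless b9 socket of Prop. 3's frame in print's both-points class (`SB9P : SockB9P3H2 …`,
  threshold `cB9`), Theorem 8's constants `c59 cP3 γ₈ γ′ γ″ γβ B₈ B₈β` with the four layer equations and the sourced free-constant guard, the two sourced b9 sockets
  (`SH59src`, `SB9srcHP` — Hölder line both-points) — all at collar law members ONLY —, Proposition 5 ∃∕! at `lan` (`p5e p5u`), Proposition 6 on the record's cube
  family at `c₁` (`p6`).  NO `p7` binder.
NET for N05 after «P₂C»: the printed members Lemma 1, Thm 2, Prop 3, Thm 4, **Prop 7**, Thm 8 are supplied by tree theorems in this knit; Prop 5 is served at print's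
`zdLan` family (D9c pattern) and Prop 6 at the print-class cut (D9d pattern) by the sibling twins; what stays DISPLAYED is N06 content only ([4]-type sockets ∕ letters at
the collar law members) + constants ∕ layer equations ∕ guards.
HONEST FRAMING: kernel bookkeeping by name; the sockets are HYPOTHESES ([Balaban1985BackgroundPropagators]-type statements; their satisfiability at `m ≥ 1` is the N06
lineage's OPEN content, NOT claimed); Proposition 7 enters in the REPAIRED-CONSTANT currency `C₇ = 530·D·L²` — WEAKER than print's `2α₂` (ref-A g26 WATCH-P7-CURRENCY-RECORD:
a statement-of-record change the planners display; consumers are threshold-existential in `α₂`, `B8Ineq145.thm2_after_prop7RepairedC`); count-neutral; **N05 NOT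
discharged**; Bałaban AS PRINTED with locators; constants sufficient, not optimal; one finite 𝕋⁴ programme at fixed ε; nothing continuum ∕ ℝ⁴ ∕ OS ∕ mass-gap ∕ Clay.
No `sorry`, no new definition.  Unit `pub-ymgap-dag-n05-d` (g11), 2026-08-28.
[cite: Balaban1985RegularSpaces, Lemma 1 p.79, Thm 2 p.83, Prop. 3 p.87 + (1.61), Thm 4 p.88, Prop. 5 (1.106)–(1.110) p.94, Prop. 6 (1.131)–(1.138) p.99, Prop. 7 (1.143)–(1.145) p.100, Thm 8 (1.146) p.101, (1.3)–(1.4) p.77, (1.31) p.82, (1.35)–(1.36) p.82; Balaban1985BackgroundPropagators, Thm 3.1 p.397, Thm 3.3 p.398, (3.40) p.397]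
-/

noncomputable section

namespace Summit.QuantumFields.YangMills.BalabanUVNodes.N05SubBP2DK2KnitGammaPrime

open Literature.MathematicalPhysics.QuantumFieldTheory.Balaban1983to89
open Literature.MathematicalPhysics.QuantumFieldTheory.Balaban1983to89.Node00
open Literature.MathematicalPhysics.QuantumFieldTheory.Balaban1983to89.B8Eq134Admissible (Admissible134)
open Literature.MathematicalPhysics.QuantumFieldTheory.Balaban1983to89.B8IdxB8LawsB (IdxB8LawsB IdxB8SubB)
open Literature.MathematicalPhysics.QuantumFieldTheory.Balaban1983to89.B8LeafModelZd (ZdIdx)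
open Literature.MathematicalPhysics.QuantumFieldTheory.Balaban1983to89.B8LeafModelZd3 (SockB9P3)
open Literature.MathematicalPhysics.QuantumFieldTheory.Balaban1983to89.B9SupplySockB9P3ZdGammaUnivDelta2 (SockB9P3H2)
open Literature.MathematicalPhysics.QuantumFieldTheory.Balaban1983to89.B8LeafModelZd3P (zdGF3P zdGF3HP)
open Literature.MathematicalPhysics.QuantumFieldTheory.Balaban1983to89.B8LeafModelZd3P2 (zdGF3P₂ zdGF3HP₂ prop7RepairedC_zdGF3HP₂_iff)
open Literature.MathematicalPhysics.QuantumFieldTheory.Balaban1983to89.B8LeafKnitRSC (B8LeafRSC)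
open Literature.MathematicalPhysics.QuantumFieldTheory.Balaban1983to89.B8Prop7TowerAxialRecord (toAxialTowerResid)
open Literature.MathematicalPhysics.QuantumFieldTheory.Balaban1983to89.B8Prop7TowerAxialRecordP (prop7RepairedC_famB8OfRecordSubBP_toAxialTower_admissible)
open Literature.MathematicalPhysics.QuantumFieldTheory.Balaban1983to89.B8TowerBondsPrinted (towerBondsP)
open Literature.MathematicalPhysics.QuantumFieldTheory.Balaban1983to89.B8SockLettersRD (SockLettersRD)
open Literature.MathematicalPhysics.QuantumFieldTheory.Balaban1983to89.B8Lemma1NonAbelian (mulCfg blockPairNA)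
open Literature.MathematicalPhysics.QuantumFieldTheory.Balaban1983to89.B8LeafKnitZdGF3P2GammaPrime (b8LeafRSC_zdGF3HP₂_mapJ_γ')
open Literature.MathematicalPhysics.QuantumFieldTheory.Balaban1983to89.B8Prop3PrintedZdGF3P2Gamma (prop3Printed_zdGF3P₂_map_γ)
open Literature.MathematicalPhysics.QuantumFieldTheory.Balaban1983to89.B8SockSP5UniformThresholdsSrcGammaPrime (exists_uniform_threshold_sp5_src_γ' exists_uniform_threshold_sp5base_src_γ' exists_uniform_threshold_sp5u_src_γ')
open Literature.MathematicalPhysics.QuantumFieldTheory.Balaban1983to89.B8LanF146 (LanF146 lanF146_zero_iff)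
open Literature.MathematicalPhysics.QuantumFieldTheory.Balaban1983to89.B8Eq138LandauZd (covLap QT InR138 IsLandau146W inR138_zero)
open Summit.QuantumFields.YangMills.BalabanUVNodes.N05SubBP2DK2T8SrvGammaPrime (t8P₂DK2_of_socketsSrc_γ')
open MatrixLog B7Prop1Explicit B7Prop2Explicit B7Prop1Local B7Eq92Concrete
open B8Ineq130 (tlo thi)
open B8Ineq132 (InAk covDerivFwd)
open B7Eq78Linearization (zdBlocking QprimeIter)
open B8Eq119TwistedAxial (bgT Restr129 InAx)
open B8Eq140Level (SideTouches)
open B8Eq1117Concrete (XSpace)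
open B8Prop5ContractionKLevel (Bd2)
open B8LambdaSpaceKLevel (wt)
open B8Eq184Proof (gaugeExp cfgExp)
open B8Eq146AExpansion (iEta plaqCovDeriv)
open B8Eq143PlaqExpansion (pdiv)
open B7Prop4GeneralLevels (linCovIter)
open B8Eq155JBound (Jcur wsup)
open B8ScaledSupNorm (bondNorm msup Bdd msup_le bdd_of_forall)
open B9Eq340HolderZd (hquot AdmPair)

-- `Site` alone could resolve to the torus sites of `Setup.lean`; re-export the `ℤ^d` sites of `B7Prop1Explicit`.
export B7Prop1Explicit (Site)

section KnitP2C

/-- ★★★ **THE «P₂C» KNIT — `B8LeafRSC` ON THE COLLAR SUB-FAMILY OF THE EDITION-δ₂ CARRIER, PROPOSITION 7 SERVED** — for the record's `θ` (`D ≥ 2`), residual layer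
`λ`, any Proposition-5 family `lan : J → B8.LandauData` and Prop.-6 threshold `c₁`: from [4]'s letters (`SLet`, `SLetUB`) and the sourceless b9 socket of Prop. 3's
frame in print's both-points Hölder class (`SB9P : SockB9P3H2 …`, `cB9`) at the COLLAR law members (`i.Ω 0 = univ ∧ IdxB8LawsB θ.L i ∧ DomainSeq θ.L i.Ω`), Theorem 8's
constants with the four layer equations and the sourced free-constant guard, the two SOURCED b9 sockets `SH59src` (`c59`) ∕ `SB9srcHP` (`cP3`, Hölder line both-points) at
the collar law members, and the displayed `p5e p5u p6`: the leaf `B8LeafRSC … (530·θ.D·θ.L²) … (zdGF3HP₂ ∘ ·.1.1.1) lan (cubB8OfRecord ∘ ·.1) (toAxialTowerResid ∘ ·.1.1)`.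
PROOF (D9b's, token for token, plus ONE served conjunct): `p7 :=` dag-n05-w1's `prop7RepairedC_famB8OfRecordSubBP_toAxialTower_domainSeq λ.β λ.len hD` (p602967)
through `prop7RepairedC_zdGF3HP₂_iff`; `SP5base`∕`SP5`∕`SP5u` (γ′) below ONE member-uniform threshold from dag-n05-w4's `exists_uniform_threshold_sp5{base,,u}_src_γ'`;
`hP3 := prop3Printed_zdGF3P₂_map_γ` at `ι := (·.1.1.1)`; `t8 := t8P₂DK2_of_socketsSrc_γ'`; the leaf by dag-n05-w2's `b8LeafRSC_zdGF3HP₂_mapJ_γ'` at `ι := (·.1.1.1)`,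
`Φ := Site → 𝔸`, `Adm :=` Theorem 8's source premiss ρ2, `LanF := LanF146`, zero source `φ₀ := 0`.
[cite: Balaban1985RegularSpaces, Lemma 1 p.79, Thm 2 p.83, Prop. 3 p.87, Thm 4 p.88, Prop. 5 p.94, Prop. 6 p.99, Prop. 7 (1.144)–(1.145) p.100, Thm 8 (1.146) p.101, (1.3)–(1.4) p.77; Balaban1985BackgroundPropagators, Thm 3.1 p.397, Thm 3.3 p.398] -/
theorem b8LeafRSC_P2DK2_of_knit_lettersSrc_γ' {θ : Stage3Params} (lam : ResidB8 θ) (Mκ Rκ : ℕ) (hD : 2 ≤ θ.D)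
    {cB9 B₀'H B₂' BG BR cL : ℝ}
    (hC₂eq : lam.C₂ = 2097152 * ((θ.D : ℝ) + 1) ^ 2 * (θ.L : ℝ) ^ 2)
    (hcB9 : 0 < cB9) (hB₀'H : 0 < B₀'H) (hB₂' : 0 ≤ B₂') (hBG : 0 ≤ BG) (hBR : 0 ≤ BR) (hcL : 0 < cL)
    -- [4]'s letters AT THE `Ω₀ = ℤᵈ` LAW MEMBERS ONLY: existence side (laws on print's domains) and uniqueness side
    (SLet : ∀ i : ZdIdx θ.D θ.L, i.Ω 0 = Set.univ → IdxB8LawsB θ.L i → B8ConstraintBonds.DomainSeq θ.L i.Ω → (∀ l, l < i.k → ∀ z ∈ i.Λs i.k l, ((θ.L : ℤ) ^ l) • z ∈ B8ConstraintBonds.Lam θ.L i.Ω l) → Admissible134 θ.L Mκ Rκ i.k i.Ω → SockLettersRD (𝔸 := θ.𝔸) θ.L BG BR B₀'H B₂' cL i.η i.k i.Ω i.Λs)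
    (SLetUB : ∀ i : ZdIdx θ.D θ.L, i.Ω 0 = Set.univ → IdxB8LawsB θ.L i → B8ConstraintBonds.DomainSeq θ.L i.Ω → (∀ l, l < i.k → ∀ z ∈ i.Λs i.k l, ((θ.L : ℤ) ^ l) • z ∈ B8ConstraintBonds.Lam θ.L i.Ω l) → Admissible134 θ.L Mκ Rκ i.k i.Ω → ∀ α₀ : ℝ, 0 < α₀ → α₀ ≤ cL → ∀ U₀ : Site θ.D → Fin θ.D → θ.𝔸ˣ, (∀ x κ, U₀ x κ ∈ unitaryUnits θ.𝔸) →
      InAk θ.L i.k i.η α₀ i.Ω U₀ →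
      ∃ (g Δ : (Site θ.D → θ.𝔸) →ₗ[ℂ] (Site θ.D → θ.𝔸)) (q : (Site θ.D → θ.𝔸) →ₗ[ℂ] (ℕ → Site θ.D → θ.𝔸))
        (qs : (ℕ → Site θ.D → θ.𝔸) →ₗ[ℂ] (Site θ.D → θ.𝔸)) (Aw c : (ℕ → Site θ.D → θ.𝔸) →ₗ[ℂ] (ℕ → Site θ.D → θ.𝔸))
        (H' : XSpace θ.D i.k θ.𝔸 →ₗ[ℂ] (Site θ.D → θ.𝔸)),
        (∀ x : Site θ.D → θ.𝔸, (∃ C : ℝ, ∀ y, ‖x y‖ ≤ C) → g (Δ x + qs (Aw (q x))) = x) ∧ (∀ φ, qs (c (q (g (g (qs φ))))) = qs φ) ∧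
        (∀ (f : Site θ.D → θ.𝔸), ∀ x ∈ i.Ω 0, Δ f x = covLap i.η U₀ ((i.Ω 0).indicator f) x) ∧
        (∀ (μ : ℕ → Site θ.D → θ.𝔸), ∀ x ∈ i.Ω 0, qs μ x = QT θ.L i.k (i.Λs i.k) U₀ μ x) ∧
        (∀ (f : Site θ.D → θ.𝔸) (n : ℕ), n ≤ i.k → ∀ y ∈ i.Λs i.k n, q f n y = QprimeIter (zdBlocking θ.D θ.L) (bgT θ.L U₀) n f y) ∧
        (∀ (f : Site θ.D → θ.𝔸) (n : ℕ) (y : Site θ.D), ¬ (n ≤ i.k ∧ y ∈ i.Λs i.k n) → q f n y = 0) ∧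
        (∀ (X : XSpace θ.D i.k θ.𝔸) (x : Site θ.D), ‖H' X x‖ ≤ B₀'H * ‖X‖) ∧
        (∀ n, n ≤ i.k → ∀ (X : XSpace θ.D i.k θ.𝔸), ∀ p ∈ {b : Site θ.D × Fin θ.D | SideTouches (i.Ω n) b.1 b.2},
          wt θ.L i.η n * ‖covDerivFwd i.η U₀ p.2 (H' X) p.1‖ ≤ B₀'H * ‖X‖) ∧
        (∀ X : XSpace θ.D i.k θ.𝔸, Bd2 θ.L i.η i.k i.Ω (covLap i.η U₀ (H' X)) (B₂' * ‖X‖)) ∧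
        (∀ (Y : XSpace θ.D i.k θ.𝔸) (n : ℕ) (hn : n ≤ i.k) (y : Site θ.D), y ∈ i.Λs i.k n →
          QprimeIter (zdBlocking θ.D θ.L) (bgT θ.L U₀) n (H' Y) y = Y (⟨n, Nat.lt_succ_of_le hn⟩, y)) ∧
        (∀ (f : Site θ.D → θ.𝔸) (r : ℝ), 0 ≤ r → Bd2 θ.L i.η i.k i.Ω f r →
          (∀ x, ‖g f x‖ ≤ BG * r) ∧ ∀ n, n ≤ i.k → ∀ p ∈ {b : Site θ.D × Fin θ.D | SideTouches (i.Ω n) b.1 b.2},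
            wt θ.L i.η n * ‖covDerivFwd i.η U₀ p.2 (g f) p.1‖ ≤ BG * r) ∧
        (∀ (f : Site θ.D → θ.𝔸) (r : ℝ), 0 ≤ r → Bd2 θ.L i.η i.k i.Ω f r → Bd2 θ.L i.η i.k i.Ω (f - g (qs (c (q (g f))))) (BR * r)))
    -- the SOURCELESS b9 socket of Proposition 3's frame over PRINT's class, at the law members only ([4] Thm 3.3; threshold `cB9`) — for Prop. 3 AS PRINTED
    (SB9P : ∀ i : ZdIdx θ.D θ.L, i.Ω 0 = Set.univ → IdxB8LawsB θ.L i → B8ConstraintBonds.DomainSeq θ.L i.Ω → (∀ l, l < i.k → ∀ z ∈ i.Λs i.k l, ((θ.L : ℤ) ^ l) • z ∈ B8ConstraintBonds.Lam θ.L i.Ω l) →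
      Admissible134 θ.L Mκ Rκ i.k i.Ω →
      SockB9P3H2 (𝔸 := θ.𝔸) θ.L lam.inp.B₀ lam.B₀β cB9 lam.β lam.len i.η i.k i.Ω i.Λs (fun m j => towerBondsP θ.L i.Ω (i.Λs m) j))
    -- PROPOSITION 5 at an arbitrary family `lan`, PROPOSITION 6 on the record's cube family at `c₁` — DISPLAYED (Proposition 7 is SERVED below)
    {J : Type} {lan : J → B8.LandauData}
    (p5e : B8.Prop5Exists lam.inp.B₀' lam.B₁ lan) (p5u : B8.Prop5Unique lan)
    (c₁ : ℝ) (p6 : B8.Prop6Printed θ.D (θ.L : ℝ) lam.B₁ c₁ (fun jB : IdxB8SubB θ => cubB8OfRecord θ jB.1))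
    -- THEOREM 8's CONSTANTS, the layer equations, the sourced free-constant guard, the two SOURCED b9 sockets at the law members
    {c59 cP3 γ₈ γ' γ'' γβ B₈ B₈β : ℝ} (hc59 : 0 < c59) (hcP3 : 0 < cP3) (hγ₈ : 1 ≤ γ₈) (hγ' : 0 ≤ γ') (hγ'' : 0 ≤ γ'')
    (hB : 2 ≤ 5 * (θ.D : ℝ) * θ.L * lam.inp.B₀) (hB₀β : 0 < lam.B₀β) (hB₀8 : lam.inp.B₀ ≤ B₈)
    (hγB : 5 * (θ.D : ℝ) * θ.L * lam.inp.B₀ + 2 * (γ' * lam.inp.B₀) ≤ 5 * (θ.D : ℝ) * θ.L * B₈)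
    (hγB'' : 5 * (θ.D : ℝ) * θ.L * lam.inp.B₀ + 2 * (γ'' * lam.inp.B₀) ≤ 5 * (θ.D : ℝ) * θ.L * B₈)
    (hB8β : 5 * (θ.D : ℝ) * θ.L * lam.B₀β + 2 * lam.B₀β * (γ'' * lam.inp.B₀) + γβ ≤ 5 * (θ.D : ℝ) * θ.L * B₈β)
    (hB₁' : lam.B₁' = 5 * (θ.D : ℝ) * θ.L * B₈)
    (hB₁eq : lam.B₁ = 5 * (θ.D : ℝ) * θ.L * B₈ * (1 + 11 * (θ.D : ℝ) ^ 2)) (hB₂eq : lam.B₂ = 5 * (θ.D : ℝ) * θ.L * B₈β * (1 + 11 * (θ.D : ℝ) ^ 2))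
    (hfreeS : 3 * (2 * (θ.D : ℝ) * (θ.L : ℝ) ^ 2) * BG * BR * (B₈ + γ₈) ≤ lam.inp.B₀' * B₈)
    -- [Balaban1985BackgroundPropagators] Thm 3.3 WITH SOURCE in Theorem 4's frame at (1.146), γ′ letter, threshold `c59`, at the law members ONLY — HYPOTHESIS
    (SH59src : ∀ i : ZdIdx θ.D θ.L, i.Ω 0 = Set.univ → IdxB8LawsB θ.L i → B8ConstraintBonds.DomainSeq θ.L i.Ω → (∀ l, l < i.k → ∀ z ∈ i.Λs i.k l, ((θ.L : ℤ) ^ l) • z ∈ B8ConstraintBonds.Lam θ.L i.Ω l) → Admissible134 θ.L Mκ Rκ i.k i.Ω → ∀ α₀ α₁ : ℝ, 0 < α₀ → 0 < α₁ → α₀ + α₁ ≤ c59 →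
      ∀ U₀ U' : Site θ.D → Fin θ.D → θ.𝔸ˣ, (∀ x κ, U₀ x κ ∈ unitaryUnits θ.𝔸) → (∀ x κ, U' x κ ∈ unitaryUnits θ.𝔸) →
      ∀ φ : Site θ.D → θ.𝔸, ((InR138 θ.L i.k i.η (i.Ω 0) (i.Λs i.k) U₀ φ ∧ (∀ x, IsSelfAdjoint (φ x)) ∧ (∀ x, x ∉ i.Ω 0 → φ x = 0) ∧
          Bdd θ.L i.k i.η (-(2 : ℝ)) (fun j (x : Site θ.D) => x ∈ i.Ω j) φ) ∧
        msup θ.L i.k i.η (-(2 : ℝ)) (fun j (x : Site θ.D) => x ∈ i.Ω j) φ < γ₈ * (α₀ + α₁)) →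
      InAk θ.L i.k i.η α₀ i.Ω U₀ → InAk θ.L i.k i.η α₀ i.Ω (mulCfg U' U₀) → (∀ m, m ≤ i.k → InAx θ.L m (i.Λs m) U₀ (mulCfg U' U₀)) →
      (∀ j, j ≤ i.k → ∀ (z : Site θ.D) (μ : Fin θ.D),
        ((∀ x, InBox (tlo θ.L z j) (thi θ.L z j) x → x ∈ i.Ω j) ∨ (∀ x, InBox (tlo θ.L (z + e μ) j) (thi θ.L (z + e μ) j) x → x ∈ i.Ω j)) →
        ‖(avgIter θ.L (mulCfg U' U₀) j z μ : θ.𝔸) - (avgIter θ.L U₀ j z μ : θ.𝔸)‖ ≤ α₁) →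
      (∀ b ∈ {b : Site θ.D × Fin θ.D | SideTouches (i.Ω 0) b.1 b.2}, ‖((U' b.1 b.2 : θ.𝔸ˣ) : θ.𝔸) - 1‖ ≤ α₁) →
      (∀ m, 1 ≤ m → m ≤ i.k → ∀ (u : Site θ.D → θ.𝔸ˣ) (W : Site θ.D → Fin θ.D → θ.𝔸ˣ) (A' : Site θ.D → Fin θ.D → θ.𝔸),
        (∀ x, u x ∈ unitaryUnits θ.𝔸) → mgauge U₀ u W = U' → Restr129 θ.L m (i.Λs m) U₀ u → LanF146 θ.L i.k i.η (i.Ω 0) i.Λs U₀ φ m W →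
        (∀ y τ, IsSelfAdjoint (A' y τ)) →
        (∀ j, j ≤ m → ∀ y τ, SideTouches (i.Ω j) y τ →
        W y τ = cfgExp i.η A' y τ ∧ ‖A' y τ‖ ≤ (2 * (θ.L * (5 * (θ.D : ℝ) * θ.L * B₈ * (α₀ + α₁))) + 8 * (8 * lam.inp.B₀' * (5 * (θ.D : ℝ) * θ.L * B₈) * (α₀ + α₁))) * ((θ.L : ℝ) ^ j * i.η)⁻¹) →
        (∀ y τ, (∀ j, j ≤ m → ¬ SideTouches (i.Ω j) y τ) → A' y τ = 0) →
        msup θ.L m i.η (-(1 : ℝ)) (fun j (b : Site θ.D × Fin θ.D) => SideTouches (i.Ω j) b.1 b.2) (fun b => A' b.1 b.2)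
        ≤ lam.inp.B₀ * (bondNorm θ.L m i.η (-(3 : ℝ)) i.Ω (fun x μ => Jcur i.η U₀ A' μ x)
        + wsup 1 (fun p : {p : ℕ × (Site θ.D × Fin θ.D) // p.1 ≤ m ∧ p.2 ∈ towerBondsP θ.L i.Ω (i.Λs m) p.1} =>
        linCovIter θ.L U₀ (iEta i.η A') p.1.1 p.1.2.1 p.1.2.2)) + γ' * lam.inp.B₀ * (α₀ + α₁) ∧
        msup θ.L m i.η (-(2 : ℝ)) (fun j (t : Fin θ.D × Fin θ.D × Site θ.D) => SideTouches (i.Ω j) t.2.2 t.2.1)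
        (fun t => covDerivFwd i.η U₀ t.1 (fun z => A' z t.2.1) t.2.2)
        ≤ lam.inp.B₀ * (bondNorm θ.L m i.η (-(3 : ℝ)) i.Ω (fun x μ => Jcur i.η U₀ A' μ x)
        + wsup 1 (fun p : {p : ℕ × (Site θ.D × Fin θ.D) // p.1 ≤ m ∧ p.2 ∈ towerBondsP θ.L i.Ω (i.Λs m) p.1} =>
        linCovIter θ.L U₀ (iEta i.η A') p.1.1 p.1.2.1 p.1.2.2)) + γ' * lam.inp.B₀ * (α₀ + α₁)))
    -- THE SOURCED b9 SOCKET OF PROPOSITION 3's FRAME at the `Ω₀ = ℤᵈ` law members, threshold `cP3`, `|B₁|` over print's class at the top truncation — HYPOTHESIS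
    -- ([Balaban1985BackgroundPropagators] Thm 3.3 with source; = `B8Prop3SrcZd3HPGamma`'s input letter for letter)
    (SB9srcHP : ∀ i : ZdIdx θ.D θ.L, i.Ω 0 = Set.univ → IdxB8LawsB θ.L i → B8ConstraintBonds.DomainSeq θ.L i.Ω → (∀ l, l < i.k → ∀ z ∈ i.Λs i.k l, ((θ.L : ℤ) ^ l) • z ∈ B8ConstraintBonds.Lam θ.L i.Ω l) → Admissible134 θ.L Mκ Rκ i.k i.Ω → ∀ α₀ α₁ α₂ : ℝ, 0 < α₀ → α₀ ≤ cP3 → 0 < α₁ → 0 < α₂ → α₂ ≤ cP3 →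
      ∀ (U₀ W : Site θ.D → Fin θ.D → θ.𝔸ˣ), (∀ x κ, U₀ x κ ∈ unitaryUnits θ.𝔸) → (∀ x κ, W x κ ∈ unitaryUnits θ.𝔸) →
      ∀ f : Site θ.D → θ.𝔸, InR138 θ.L i.k i.η (i.Ω 0) (i.Λs i.k) U₀ f →
      (∀ x, IsSelfAdjoint (f x)) → (∀ x, x ∉ i.Ω 0 → f x = 0) →
      Bdd θ.L i.k i.η (-(2 : ℝ)) (fun j (x : Site θ.D) => x ∈ i.Ω j) f →
      msup θ.L i.k i.η (-(2 : ℝ)) (fun j (x : Site θ.D) => x ∈ i.Ω j) f < γ₈ * (α₀ + α₁) →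
      msup θ.L i.k i.η (-(3 : ℝ)) (fun j (p : Fin θ.D × Site θ.D) => p.2 ∈ i.Ω j) (fun p => covDerivFwd i.η U₀ p.1 f p.2) < γ₈ * (α₀ + α₁) →
      InAk θ.L i.k i.η α₀ i.Ω U₀ → InAk θ.L i.k i.η α₀ i.Ω (mulCfg W U₀) → IsLandau146W θ.L i.k i.η (i.Ω 0) (i.Λs i.k) U₀ f W →
      ∀ A' : Site θ.D → Fin θ.D → θ.𝔸, (∀ y τ, IsSelfAdjoint (A' y τ)) →
      (∀ j, j ≤ i.k → ∀ (y : Site θ.D) (τ : Fin θ.D), SideTouches (i.Ω j) y τ →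
        W y τ = cfgExp i.η A' y τ ∧ ‖A' y τ‖ ≤ α₂ * ((θ.L : ℝ) ^ j * i.η)⁻¹) →
      (∀ (y : Site θ.D) (τ : Fin θ.D), (∀ j, j ≤ i.k → ¬ SideTouches (i.Ω j) y τ) → A' y τ = 0) →
      msup θ.L i.k i.η (-(1 : ℝ)) (fun j (b : Site θ.D × Fin θ.D) => SideTouches (i.Ω j) b.1 b.2) (fun b => A' b.1 b.2)
          ≤ lam.inp.B₀ * (bondNorm θ.L i.k i.η (-(3 : ℝ)) i.Ω (fun x μ => Jcur i.η U₀ A' μ x)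
            + wsup 1 (fun p : {p : ℕ × (Site θ.D × Fin θ.D) // p.1 ≤ i.k ∧ p.2 ∈ towerBondsP θ.L i.Ω (i.Λs i.k) p.1} =>
                linCovIter θ.L U₀ (iEta i.η A') p.1.1 p.1.2.1 p.1.2.2)) + γ'' * lam.inp.B₀ * (α₀ + α₁) ∧
        msup θ.L i.k i.η (-(2 : ℝ)) (fun j (t : Fin θ.D × Fin θ.D × Site θ.D) => SideTouches (i.Ω j) t.2.2 t.2.1)
            (fun t => covDerivFwd i.η U₀ t.1 (fun z => A' z t.2.1) t.2.2)
          ≤ lam.inp.B₀ * (bondNorm θ.L i.k i.η (-(3 : ℝ)) i.Ω (fun x μ => Jcur i.η U₀ A' μ x)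
            + wsup 1 (fun p : {p : ℕ × (Site θ.D × Fin θ.D) // p.1 ≤ i.k ∧ p.2 ∈ towerBondsP θ.L i.Ω (i.Λs i.k) p.1} =>
                linCovIter θ.L U₀ (iEta i.η A') p.1.1 p.1.2.1 p.1.2.2)) + γ'' * lam.inp.B₀ * (α₀ + α₁) ∧
        bondNorm θ.L i.k i.η (-(3 : ℝ)) i.Ω (fun x μ => pdiv i.η U₀ (plaqCovDeriv i.η U₀ A') μ x)
          ≤ lam.inp.B₀ * (bondNorm θ.L i.k i.η (-(3 : ℝ)) i.Ω (fun x μ => Jcur i.η U₀ A' μ x)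
            + wsup 1 (fun p : {p : ℕ × (Site θ.D × Fin θ.D) // p.1 ≤ i.k ∧ p.2 ∈ towerBondsP θ.L i.Ω (i.Λs i.k) p.1} =>
                linCovIter θ.L U₀ (iEta i.η A') p.1.1 p.1.2.1 p.1.2.2)) + γ'' * lam.inp.B₀ * (α₀ + α₁) ∧
        bondNorm θ.L i.k i.η (-(3 : ℝ)) i.Ω (fun x μ => covLap i.η U₀ (fun z => A' z μ) x)
          ≤ lam.inp.B₀ * (bondNorm θ.L i.k i.η (-(3 : ℝ)) i.Ω (fun x μ => Jcur i.η U₀ A' μ x)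
            + wsup 1 (fun p : {p : ℕ × (Site θ.D × Fin θ.D) // p.1 ≤ i.k ∧ p.2 ∈ towerBondsP θ.L i.Ω (i.Λs i.k) p.1} =>
                linCovIter θ.L U₀ (iEta i.η A') p.1.1 p.1.2.1 p.1.2.2)) + γ'' * lam.inp.B₀ * (α₀ + α₁) ∧
        msup θ.L i.k i.η (-(2 + lam.β)) (fun j (q : Fin θ.D × Fin θ.D × (Site θ.D × Site θ.D)) => q.2.2 ∈ AdmPair i.η lam.len ∧ q.2.2.1 ∈ i.Ω j ∧ q.2.2.2 ∈ i.Ω j)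
            (fun q => hquot i.η lam.β lam.len U₀ (covDerivFwd i.η U₀ q.1 (fun z => A' z q.2.1)) q.2.2)
          ≤ lam.B₀β * (bondNorm θ.L i.k i.η (-(3 : ℝ)) i.Ω (fun x μ => Jcur i.η U₀ A' μ x)
            + wsup 1 (fun p : {p : ℕ × (Site θ.D × Fin θ.D) // p.1 ≤ i.k ∧ p.2 ∈ towerBondsP θ.L i.Ω (i.Λs i.k) p.1} =>
                linCovIter θ.L U₀ (iEta i.η A') p.1.1 p.1.2.1 p.1.2.2)) + γβ * (α₀ + α₁)) :
    B8LeafRSC θ.D (θ.L : ℝ) lam.C₂ lam.B₁' lam.inp.B₀' lam.B₁ lam.B₂ c₁ lam.inp lam.B₀β (530 * (θ.D : ℝ) * (θ.L : ℝ) ^ 2) (blockPairNA θ.D θ.L θ.𝔸)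
      (fun j : IdxB8SubDκ θ Mκ Rκ => zdGF3HP₂ θ.𝔸 θ.L lam.β lam.len j.1.1.1.1.1) lan
      (fun jB : IdxB8SubB θ => cubB8OfRecord θ jB.1) (fun j => toAxialTowerResid θ lam.β lam.len j.1.1.1.1) := by
  -- PROPOSITION 7 SERVED (repaired constant 530·D·L², print's tower-wise axial map) on the DomainSeq (collar) sub-family: dag-n05-w1's record face at `e := (·.1)`
  -- (v1.1 `_domainSeq`, collar law from `DomainSeq` by dag-n05-w2's `collar_of_domainSeq'`), transferred from `zdGF3HP` to the edition-δ₂ carrier (Proposition 7 does not read (1.36))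
  have p7 : B8Ineq145.Prop7RepairedC (530 * (θ.D : ℝ) * (θ.L : ℝ) ^ 2) (fun j : IdxB8SubDκ θ Mκ Rκ => zdGF3HP₂ θ.𝔸 θ.L lam.β lam.len j.1.1.1.1.1)
      (fun j => toAxialTowerResid θ lam.β lam.len j.1.1.1.1) :=
    (prop7RepairedC_zdGF3HP₂_iff (𝔸 := θ.𝔸) (fun j : IdxB8SubDκ θ Mκ Rκ => j.1.1.1.1.1) _ _).2
      (prop7RepairedC_famB8OfRecordSubBP_toAxialTower_admissible lam.β lam.len hD (fun j : IdxB8SubDκ θ Mκ Rκ => j.1.1.1) (fun j => j.1.1.2))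
  -- constants: `0 < B₀ ≤ B₈`, `2 ≤ 5dLB₀ ≤ 5dLB₈`, `0 ≤ γ₈`, `2γ′B₀ ≤ 5dLB₈`
  have hB₀ : 0 < lam.inp.B₀ := lam.inp.B₀_pos
  have hB₈ : 0 < B₈ := lt_of_lt_of_le hB₀ hB₀8
  have h5 : 0 ≤ 5 * (θ.D : ℝ) * θ.L := by positivity
  have hB8' : 2 ≤ 5 * (θ.D : ℝ) * θ.L * B₈ := hB.trans (mul_le_mul_of_nonneg_left hB₀8 h5)
  have hγ₈0 : 0 ≤ γ₈ := zero_le_one.trans hγ₈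
  have hγ₈pos : 0 < γ₈ := lt_of_lt_of_le one_pos hγ₈
  have hγB2 : 2 * (γ' * lam.inp.B₀) ≤ 5 * (θ.D : ℝ) * θ.L * B₈ :=
    le_trans (le_add_of_nonneg_left (mul_nonneg h5 hB₀.le)) hγB
  -- PROPOSITION 5 ∃∕! WITH SOURCE in the γ′ letters: the three sourced sockets below member-UNIFORM thresholds (dag-n05-w4)
  obtain ⟨cP5, hcP5, H5⟩ := exists_uniform_threshold_sp5_src_γ' (𝔸 := θ.𝔸) (γ := γ₈) hD θ.two_le_L hB8' hfreeS hcL hB₀ lam.inp.B₀'_pos hB₀'H hB₂' hBG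
    hBR hγ₈0 hγ' hB₀8 hγB2 hc59
  obtain ⟨cPb, hcPb, Hb⟩ := exists_uniform_threshold_sp5base_src_γ' (𝔸 := θ.𝔸) (γ := γ₈) hD θ.two_le_L hfreeS hcL lam.inp.B₀'_pos hB₀'H hB₂' hBG hBR hγ₈0
    hB₈ hB8'
  obtain ⟨cu, cPu, hcu, hcPu, Hu⟩ := exists_uniform_threshold_sp5u_src_γ' (𝔸 := θ.𝔸) (γ := γ₈) hD θ.two_le_L hB8' hcL hB₀ lam.inp.B₀'_pos hB₀'H hB₂' hBG hBR
    hγ₈0 hγ' hB₀8 hγB2 hc59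
  -- ONE threshold for the four Prop-5-type sockets
  have hcP : 0 < min c59 (min cPb (min cP5 cPu)) := lt_min hc59 (lt_min hcPb (lt_min hcP5 hcPu))
  have hP59 : min c59 (min cPb (min cP5 cPu)) ≤ c59 := min_le_left _ _
  have hPb : min c59 (min cPb (min cP5 cPu)) ≤ cPb := (min_le_right _ _).trans (min_le_left _ _)
  have hP5 : min c59 (min cPb (min cP5 cPu)) ≤ cP5 := (min_le_right _ _).trans ((min_le_right _ _).trans (min_le_left _ _))
  have hPu : min c59 (min cPb (min cP5 cPu)) ≤ cPu := (min_le_right _ _).trans ((min_le_right _ _).trans (min_le_right _ _))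
  -- PROPOSITION 3 AS PRINTED on the P-carrier at the law members (this seat's D3, index-map form)
  have hP3 := prop3Printed_zdGF3P₂_map_γ (𝔸 := θ.𝔸) hD θ.two_le_L lam.inp hB₀β.le (le_of_eq hC₂eq.symm) hcB9 lam.β lam.len
    (fun j : IdxB8SubDκ θ Mκ Rκ => j.1.1.1.1.1) (fun j => SB9P j.1.1.1.1.1 j.1.1.1.1.2 j.1.1.1.2 j.1.1.2 j.1.2 j.2)
  -- THEOREM 8 SURVIVING at the P-members (this seat's D9a, sockets served as above)
  have t8 := t8P₂DK2_of_socketsSrc_γ' lam Mκ Rκ hD hcP hcu hcP3 hγ₈ hγ' hγ'' hB hB₀β hB₀8 hγB hγB'' hB8β hB₁eq hB₂eq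
    (fun i hΩ hl hds hlt hκ α₀ α₁ hα₀ hα₁ hs => Hb i.η i.k i.Ω i.Λs (fun m j => towerBondsP θ.L i.Ω (i.Λs m) j) i.hη i.hk i.hΩ
      hl.toIdxB8Laws.tower_all (SLet i hΩ hl hds hlt hκ) α₀ α₁ hα₀ hα₁ (hs.trans hPb))
    (fun i hΩ hl hds hlt hκ α₀ α₁ hα₀ hα₁ hs => H5 i.η i.k i.Ω i.Λs (fun m j => towerBondsP θ.L i.Ω (i.Λs m) j) i.hη i.hΩ
      (B8TowerBondsPrinted.ZdIdx.towerBondsP_laws i).1 (B8TowerBondsPrinted.ZdIdx.towerBondsP_laws i).2 hl.toIdxB8Laws.tower_all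
      hl.trunc_lt hl.trunc_top (SLet i hΩ hl hds hlt hκ) (SH59src i hΩ hl hds hlt hκ) α₀ α₁ hα₀ hα₁ (hs.trans hP5))
    (fun i hΩ hl hds hlt hκ α₀ α₁ hα₀ hα₁ hs => SH59src i hΩ hl hds hlt hκ α₀ α₁ hα₀ hα₁ (hs.trans hP59))
    (fun i hΩ hl hds hlt hκ α₀ α₁ hα₀ hα₁ hs => Hu i.η i.k i.Ω i.Λs (fun m j => towerBondsP θ.L i.Ω (i.Λs m) j) i.hη i.hk i.hΩ hΩ
      (B8TowerBondsPrinted.ZdIdx.towerBondsP_laws i).1 (B8TowerBondsPrinted.ZdIdx.towerBondsP_laws i).2 i.htower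
      (SLetUB i hΩ hl hds hlt hκ) (SH59src i hΩ hl hds hlt hκ) α₀ α₁ hα₀ hα₁ (hs.trans hPu))
    SB9srcHP
  -- THE γ′ LEAF (dag-n05-w2: Lemma 1 kernel, Thm 2, Prop 3 := hP3, Thm 4; `p5e p5u p6 p7 t8` passed) at `ι := (·.1.1)`, source premiss ρ2, `LanF146`, zero source
  have leaf := b8LeafRSC_zdGF3HP₂_mapJ_γ' (𝔸 := θ.𝔸) (C₇ := 530 * (θ.D : ℝ) * (θ.L : ℝ) ^ 2) hD θ.two_le_L θ.L lam.β lam.len lam.inp hB₀β (le_of_eq hC₂eq) hcu hcP hγ' hB₈ hB₀8 hB8' hγB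
    (fun j : IdxB8SubDκ θ Mκ Rκ => j.1.1.1.1.1)
    (fun (j : IdxB8SubDκ θ Mκ Rκ) (f : Site θ.D → θ.𝔸) (U₀ : Site θ.D → Fin θ.D → θ.𝔸ˣ) (a0 b0 : ℝ) =>
      (InR138 θ.L j.1.1.1.1.1.k j.1.1.1.1.1.η (j.1.1.1.1.1.Ω 0) (j.1.1.1.1.1.Λs j.1.1.1.1.1.k) U₀ f ∧ (∀ x, IsSelfAdjoint (f x)) ∧ (∀ x, x ∉ j.1.1.1.1.1.Ω 0 → f x = 0) ∧
          Bdd θ.L j.1.1.1.1.1.k j.1.1.1.1.1.η (-(2 : ℝ)) (fun jj (x : Site θ.D) => x ∈ j.1.1.1.1.1.Ω jj) f) ∧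
        msup θ.L j.1.1.1.1.1.k j.1.1.1.1.1.η (-(2 : ℝ)) (fun jj (x : Site θ.D) => x ∈ j.1.1.1.1.1.Ω jj) f < γ₈ * (a0 + b0))
    (fun (j : IdxB8SubDκ θ Mκ Rκ) (U₀ : Site θ.D → Fin θ.D → θ.𝔸ˣ) (f : Site θ.D → θ.𝔸) (m : ℕ) (W : Site θ.D → Fin θ.D → θ.𝔸ˣ) =>
      LanF146 θ.L j.1.1.1.1.1.k j.1.1.1.1.1.η (j.1.1.1.1.1.Ω 0) j.1.1.1.1.1.Λs U₀ f m W)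
    (fun j α₀ α₁ hα₀ hα₁ hs => Hb j.1.1.1.1.1.η j.1.1.1.1.1.k j.1.1.1.1.1.Ω j.1.1.1.1.1.Λs (fun m jj => towerBondsP θ.L j.1.1.1.1.1.Ω (j.1.1.1.1.1.Λs m) jj) j.1.1.1.1.1.hη j.1.1.1.1.1.hk j.1.1.1.1.1.hΩ
      (IdxB8SubB.tower_all j.1.1.1) (SLet j.1.1.1.1.1 j.1.1.1.1.2 j.1.1.1.2 j.1.1.2 j.1.2 j.2) α₀ α₁ hα₀ hα₁ (hs.trans hPb))
    (fun j α₀ α₁ hα₀ hα₁ hs => H5 j.1.1.1.1.1.η j.1.1.1.1.1.k j.1.1.1.1.1.Ω j.1.1.1.1.1.Λs (fun m jj => towerBondsP θ.L j.1.1.1.1.1.Ω (j.1.1.1.1.1.Λs m) jj) j.1.1.1.1.1.hη j.1.1.1.1.1.hΩ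
      (B8TowerBondsPrinted.ZdIdx.towerBondsP_laws j.1.1.1.1.1).1 (B8TowerBondsPrinted.ZdIdx.towerBondsP_laws j.1.1.1.1.1).2 (IdxB8SubB.tower_all j.1.1.1)
      j.1.1.1.2.trunc_lt j.1.1.1.2.trunc_top (SLet j.1.1.1.1.1 j.1.1.1.1.2 j.1.1.1.2 j.1.1.2 j.1.2 j.2) (SH59src j.1.1.1.1.1 j.1.1.1.1.2 j.1.1.1.2 j.1.1.2 j.1.2 j.2) α₀ α₁ hα₀ hα₁ (hs.trans hP5))
    (fun j α₀ α₁ hα₀ hα₁ hs => SH59src j.1.1.1.1.1 j.1.1.1.1.2 j.1.1.1.2 j.1.1.2 j.1.2 j.2 α₀ α₁ hα₀ hα₁ (hs.trans hP59))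
    (fun j α₀ α₁ hα₀ hα₁ hs => Hu j.1.1.1.1.1.η j.1.1.1.1.1.k j.1.1.1.1.1.Ω j.1.1.1.1.1.Λs (fun m jj => towerBondsP θ.L j.1.1.1.1.1.Ω (j.1.1.1.1.1.Λs m) jj) j.1.1.1.1.1.hη j.1.1.1.1.1.hk j.1.1.1.1.1.hΩ j.1.1.1.1.2
      (B8TowerBondsPrinted.ZdIdx.towerBondsP_laws j.1.1.1.1.1).1 (B8TowerBondsPrinted.ZdIdx.towerBondsP_laws j.1.1.1.1.1).2 j.1.1.1.1.1.htower
      (SLetUB j.1.1.1.1.1 j.1.1.1.1.2 j.1.1.1.2 j.1.1.2 j.1.2 j.2) (SH59src j.1.1.1.1.1 j.1.1.1.1.2 j.1.1.1.2 j.1.1.2 j.1.2 j.2) α₀ α₁ hα₀ hα₁ (hs.trans hPu))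
    (0 : Site θ.D → θ.𝔸)
    (fun j α₀ α₁ hα₀ hα₁ U₀ _ =>
      ⟨⟨inR138_zero j.1.1.1.1.1.η θ.L U₀ j.1.1.1.1.1.k (j.1.1.1.1.1.Ω 0) (j.1.1.1.1.1.Λs j.1.1.1.1.1.k), fun _ => IsSelfAdjoint.zero θ.𝔸, fun _ _ => rfl,
        bdd_of_forall (c := 0) fun _ _ _ _ => by simp⟩,
       lt_of_le_of_lt (msup_le le_rfl fun _ _ _ _ => by simp) (mul_pos hγ₈pos (add_pos hα₀ hα₁))⟩)
    (fun j U₀ W => lanF146_zero_iff θ.L j.1.1.1.1.1.k j.1.1.1.1.1.η (j.1.1.1.1.1.Ω 0) j.1.1.1.1.1.Λs U₀ j.1.1.1.1.1.k W)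
    (fun j => j.1.1.1.1.2) (fun j => IdxB8SubB.tower_all j.1.1.1) hP3 (toAxial := fun j => toAxialTowerResid θ lam.β lam.len j.1.1.1.1) p5e p5u p6 p7 t8
  rw [hB₁']
  exact leaf

end KnitP2C


end Summit.QuantumFields.YangMills.BalabanUVNodes.N05SubBP2DK2KnitGammaPrime

end
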